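import Literature.NumberTheory.EllipticCurves.KellerYin2024.AnomalousLambdaInvariants
import HarnessLib

/-!
# Castella–Grossi–Lee–Skinner 2022, Thm. 2.1.2 (= Katz 1978 / Hida–Tilouine 1993 / Kriz 2016
# Thm. 27): the anticyclotomic Katz `p`-adic `L`-function `𝓛_θ ∈ Λ^{ur}` of (the base change to
# `K` of) a `p`-unramified Dirichlet character of split conductor EXISTS — named fact

F. Castella, G. Grossi, J. Lee, C. Skinner, *On the anticyclotomic Iwasawa theory of rational
elliptic curves at Eisenstein primes*, Invent. Math. **227** (2022) 517–580, §2.1.2 (arXiv:2008.02571,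
v2-final TeX L1015–1041, VERBATIM):

> "Let `θ : G_ℚ → ℤ_p^×` be a Dirichlet character of conductor `C`. As it will suffice for our
> purposes, we assume that `C ∣ N` (so `p ∤ C`), and let `𝔠 ∣ 𝔑` be such that `𝓞_K/𝔠 = ℤ/Cℤ`. The
> next result follows from the work of Katz [Katz78], as extended by Hida–Tilouine [HT93].
> THEOREM 2.1.2. There exists an element `𝓛_θ ∈ Λ^{ur}` characterized by the following
> interpolation property: For every character `ξ` of `Γ` crystalline at both `v` and `v̄` and
> corresponding to a Hecke character of `K` of infinity type `(n, −n)` with `n ∈ ℤ_{>0}` and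
> `n ≡ 0 (mod p − 1)`, we have `𝓛_θ(ξ) = (Ω_p^{2n}/Ω_∞^{2n}) · 4Γ(n+1) · ((2πi)^{n−1}/√D_K^{n−1}) ·
> (1 − θ^{−1}(p)ξ^{−1}(v)) · (1 − θ(p)ξ(v̄)p^{−1}) × ∏_{ℓ ∣ C}(1 − θ(ℓ)ξ(w)ℓ^{−1}) · L(θ_K ξ 𝐍_K, 0)`,
> where `Ω_p` and `Ω_∞` are as in Theorem 2.1.1, and for each `ℓ ∣ C` we take the prime `w ∣ ℓ` with
> `w ∣ 𝔠`." Proof: "`𝓛_θ` is then obtained by applying `π_θ` to the Katz `p`-adic `L`-function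
> described in [Kri16, Thm. 27], setting `χ^{−1} = θ_K ξ 𝐍_K`."

Standing hypotheses of §2 (L940–942): "`p ∤ 2N` a prime of good reduction for `E`, and `K` an
imaginary quadratic field satisfying hypotheses (Heeg), (spl), and (disc) from the introduction; in
particular, `p = v v̄` splits in `K`" — (disc): `D_K` odd and `≠ −3`.

This file states the EXISTENCE as ONE named fact (D-0014) in the currency of the tree's
characterising predicate `CastellaGrossiLeeSkinner2022.IsKatzLFunction ι v v̄ Cbar κ γ θ_K Ω_K Ω_p L`
(`KatzPAdicLFunctionFrame.lean`, p415953: CGLS's display read through `ξ = φ^c`, same character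
class and evaluation points as `IsBDPLFunction`), with:

* `θ` ↦ a Teichmüller-valued character `θ : G_ℚ → GL₁(𝓞)`, `𝓞 = 𝓞_{ℚ_p(∅)} = ℤ_p ⊂ ℚ̄_p`
  (`FramedGaloisRep ℚ (padicCoeffIntegers ∅) 1` with `θ^{p−1} = 1` — for `p` odd the torsion of
  `ℤ_p^×` is `μ_{p−1}`, so this IS "a Dirichlet character `G_ℚ → ℤ_p^×`"), "conductor `C ∣ N` (so
  `p ∤ C`)" with (Heeg) for `N` ↦ `θ` unramified at every prime `ℓ ∤ C` for an integer `C` all of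
  whose prime factors split in `K` (`SatisfiesHeegnerHypothesis C K`, the tree's (Heeg)) and
  unramified at `p`;
* "`θ_K`" (the character "viewed as a character of `K`", i.e. `θ ∘ Nm`, with "`θ(p) = θ_K(ϖ_v)`")
  ↦ ANY Hecke character `θK` of `K` attached to the restriction `θ|_{G_K}`
  (`FramedGaloisRep.restrictField K θ`) by ARITHMETIC reciprocity, `KellerYin2024.IsHeckeCharOf ι θ|_K θK`
  (unramified where `θ|_K` is, with `θK(ϖ_w) = ι(θ(Frob_w^{arith}))`; such `θK` exists — tree theorem
  `EisensteinPrimesMuLambda.exists_heckeCharacter_of_pow_eq_one` from `artinReciprocity_character_holds`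
  — and is unique by the values at almost all primes, so "for every such `θK`" = "for `θ_K`");
* `Cbar = ∅`: for `C = cond θ` the away-factors `(1 − θ(ℓ)ξ(w)ℓ^{−1})` carry the Dirichlet value
  `θ(ℓ) = 0` at `ℓ ∣ C` (Kriz's extended-by-zero convention, `heckeValueExtZero`), i.e. they are
  `1` — `katzAwayFactor_eq_one_of_forall_not_isUnramifiedAt`; the frame with `Cbar = ∅` is the
  primitive `𝓛_θ`;
* "`Ω_p` and `Ω_∞` as in Theorem 2.1.1" (the CM period pair of `K`) ↦ EXISTENTIALLY quantified
  `Ω_K ∈ ℂ^×`, `Ω_p ∈ R₀^×` — WEAKER than print, exactly as in the sibling existence facts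
  `castella2018_exists_isBDPLFunction` / `castellaHsieh2018_exists_isBDPLFunction`;
* the remaining binders (`ι : K → ℚ_p` with its prime `v`, `v̄ ∋ p`, `v̄ ≠ v`, `κ` anticyclotomic with
  topological generator `γ`, the embedding datum `ι' : ℚ̄_p ≃ ℂ` inducing `v`, `D_K` odd `≠ −3`) are
  VERBATIM those of the tree's statements over the same frame
  (`KellerYin2024.thm222_anacong_goodLattice_of_ne_one`, `X1.KellerYinMuLambdaSplit.KatzLFunctionExistsFor`).

So the `Prop` below is, binder for binder, `∀ p, X1.KellerYinMuLambdaSplit.KatzLFunctionExistsFor p`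
(p428309) — the displayed PUBLISHED input [F1b] of the kernel composition of Keller–Yin's `μ/λ`
equality at the good lattice (`Theorems/EisensteinPrimesGoodLatticeMuLambdaSplit.lean`, cell
`bsd-eis`, crux 2 of route `EisensteinPrimes`), which it discharges by `fun h p _ ↦ h p`. ONE
`def … : Prop`; nothing asserted beyond the citation; no `sorry`, no instance, no notation.

References: [CastellaGrossiLeeSkinner2022] Thm. 2.1.2 (TeX L1015–1041) with §2 standing hypotheses
(L940–942); [Kriz2016] Thm. 27 (arXiv:1512.05032 p. 18); [HidaTilouine1993] (the construction for
general conductor); [Katz1978]; [KellerYin2024] §2.1.2 Thm. 2.1.3 (arXiv:2402.12781v2 TeX L1407–1419: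
the same statement in weight `k`); HOME/LIT-DOSSIER.md §35 (A) B2, (B) F1, §36 (C′).
-/

noncomputable section

open scoped Classical

open NumberField IsDedekindDomain Field
  Literature.NumberTheory.EllipticCurves Literature.NumberTheory.QuadraticFields
  Literature.NumberTheory.GaloisRepresentations Literature.NumberTheory.EllipticCurves.KellerYin2024

namespace Literature.NumberTheory.EllipticCurves.CastellaGrossiLeeSkinner2022

/-- **Castella–Grossi–Lee–Skinner, Invent. Math. 227 (2022), Thm. 2.1.2 — EXISTENCE of the
anticyclotomic Katz `p`-adic `L`-function `𝓛_θ ∈ Λ^{ur}`** ("There exists an element `𝓛_θ ∈ Λ^{ur}`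
characterized by the following interpolation property: For every character `ξ` of `Γ` crystalline at
both `v` and `v̄` and corresponding to a Hecke character of `K` of infinity type `(n, −n)` with
`n ∈ ℤ_{>0}` and `n ≡ 0 (mod p − 1)`, we have `𝓛_θ(ξ) = (Ω_p^{2n}/Ω_∞^{2n}) · 4Γ(n+1) ·
((2πi)^{n−1}/√D_K^{n−1}) · (1 − θ^{−1}(p)ξ^{−1}(v)) · (1 − θ(p)ξ(v̄)p^{−1}) × ∏_{ℓ∣C}(1 − θ(ℓ)ξ(w)ℓ^{−1})
· L(θ_K ξ 𝐍_K, 0)`"; from Katz 1978 / Hida–Tilouine 1993 via Kriz 2016 Thm. 27), named fact in the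
currency of `IsKatzLFunction` (p415953). Hypotheses as printed (module docstring, binder by binder):
`p` odd; `K` imaginary quadratic with `p = v v̄` split ((spl)), `D_K` odd and `≠ −3` ((disc)); `ι`,
`v`, `v̄`; `κ` THE anticyclotomic `ℤ_p`-extension, `γ` a topological generator; the embedding datum
`ι'` inducing `v`; `θ : G_ℚ → ℤ_p^×` a Dirichlet character (`θ^{p−1} = 1`) whose conductor is
divisible only by primes split in `K` (unramified at every `ℓ ∤ C`, `C` with (Heeg)) and prime to
`p` (unramified at `p`); `θ_K` its Hecke character over `K` (`IsHeckeCharOf`, arithmetic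
reciprocity). Conclusion: a frame `(Ω_K ≠ 0, Ω_p ∈ R₀ˣ, L)` with
`IsKatzLFunction ι' v v̄ ∅ κ γ θ_K Ω_K Ω_p L` (periods existential — weaker than print; `Cbar = ∅`:
the primitive `𝓛_θ`). PUBLISHED (Invent. Math. 2022). Binder for binder this is
`∀ p, X1.KellerYinMuLambdaSplit.KatzLFunctionExistsFor p`.
[cite: CastellaGrossiLeeSkinner2022, Thm. 2.1.2 (arXiv:2008.02571v2 TeX L1015–1041) with §2 standing hypotheses (L940–942)]
[cite: Kriz2016, Thm. 27] [cite: HidaTilouine1993, Thm. II] -/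
def thm212_exists_isKatzLFunction : Prop :=
  ∀ (p : ℕ) [Fact p.Prime],
    2 < p → ∀ (K : Type) [Field K] [NumberField K], IsImaginaryQuadratic K →
      SatisfiesHeegnerHypothesis p K → Odd (NumberField.discr K) → NumberField.discr K ≠ -3 →
    ∀ (ι : K →+* ℚ_[p]) (v vbar : HeightOneSpectrum (𝓞 K)),
      (∀ x : 𝓞 K, x ∈ v.asIdeal ↔ ‖ι (x : K)‖ < 1) →
      ((p : ℕ) : 𝓞 K) ∈ vbar.asIdeal → vbar ≠ v →
    ∀ (κ : ZpExtension K p), κ.IsAnticyclotomic →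
    ∀ (γ : absoluteGaloisGroup K) [Fact (κ.IsTopGenerator γ)],
    ∀ (ι' : PadicAlgCl p ≃+* ℂ),
      (∀ (w : InfinitePlace K) (k : 𝓞 K), k ∈ v.asIdeal ↔ ‖ι'.symm (w.embedding (k : K))‖ < 1) →
    ∀ (θ : FramedGaloisRep ℚ (padicCoeffIntegers (∅ : Set (PadicAlgCl p))) 1),
      (∀ σ : absoluteGaloisGroup ℚ, θ σ ^ (p - 1) = 1) →
    ∀ (C : ℕ), SatisfiesHeegnerHypothesis C K →
      (∀ u : HeightOneSpectrum (𝓞 ℚ), ((C : ℤ) : 𝓞 ℚ) ∉ u.asIdeal → θ.IsUnramifiedAt u) →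
      (∀ u : HeightOneSpectrum (𝓞 ℚ), ((p : ℕ) : 𝓞 ℚ) ∈ u.asIdeal → θ.IsUnramifiedAt u) →
    ∀ (θK : HeckeCharacter K), IsHeckeCharOf ι' (θ.restrictField K) θK →
    ∃ (ΩK : ℂ) (Ωp : (unrIntegers p)ˣ) (L : UnrSeries p), ΩK ≠ 0 ∧
      IsKatzLFunction ι' v vbar ∅ κ γ θK ΩK ((Ωp : unrIntegers p) : ℂ_[p]) L

end Literature.NumberTheory.EllipticCurves.CastellaGrossiLeeSkinner2022

end
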